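import Literature.AlgebraicGeometry.Frobenioids.ArchimedeanPerfectionRadialSection
import Literature.AlgebraicGeometry.Frobenioids.ArchimedeanFrobeniusIsotropic
import Literature.AlgebraicGeometry.Frobenioids.PerfectionPreSteps
import HarnessLib

/-!
# Frobenioids II, Thm. 3.6 (i) at `Λ = ℚ`, piece P2 (ii c): the radial germs do NOT depend on the Frobenius
# level — transport of the standard fractions from level `c` to level `c·k`

Mochizuki, *The geometry of Frobenioids II: poly-Frobenioids*, Kyushu J. Math. **62** (2008) 401–460, §3,
Thm. 3.6 (i) p. 36 [cite: MochizukiFrdII2008, Thm 3.6 (i) p.36]; [FrdI] Def. 3.1 (ii)/(iii) p. 56–57 (the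
inductive system `Hom_C(A′, B′)` along Frobenius conjugation, Prop. 1.10 (i)) and Prop. 4.4 p. 82 (`Hom^birat` as
an inductive limit over co-angular pre-steps) [cite: MochizukiFrdI2008, Def. 3.1 (iii) p.57].

abc-iut cell, layer L1, row M13-c3 piece **P2** (seat abc-iut-w5-d246), file 2c of the P2 chain.  For `X = (A, n)`,
a naively isotropic level `c` and a multiple `c·k` (also naively isotropic): the standard fraction of a POSITIVE
REAL scalar `r` at level `c` (source disc over `A^{(c)}`, read at level `(1, c)`) is refinement-related to the
standard fraction of scalar `r^k` at level `c·k` — refine along the arrow `disc′ → (disc)^{(k)}` into the `k`-th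
Frobenius power of the source disc that inverts the Frobenius conjugate of the scalar-`1` arrow (the conjugates of
the scalar arrows `ι_1`, `ι_r` along the transition morphisms have the same base and `D`-component and scalars in
the ratio `r^k`, positive reals being fixed by the Galois twists).  Consequence: **`radialSection_mul_eq`** — the
radial sections at levels `c` and `c·k` COINCIDE (`σ₀^{(c)} = σ₀^{(c k)}`), so `radialSection` is canonical.
Data def: the refining arrow `levelHom`; nothing here bears on [IUTchIII] Cor. 3.12.
-/

noncomputable section

namespace Literature.AlgebraicGeometry.Frobenioids

open CategoryTheory Opposite
open scoped Pointwise NNReal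

universe v u

namespace ArchFrd

namespace Thm36Sub

variable {D : Type u} [Category.{v} D] {π : D ⥤ D0}

open PreFrobenioid PreFrobenioid.Perfection

/-! ### The Frobenius power of a disc is naively isotropic -/

/-- The codomain of any arrow of `C₀` out of a disc object is naively isotropic (every direction is a `d`-th
power of a direction of the disc: `S¹` is divisible). [cite: MochizukiFrdII2008, Lem 3.2 (v) p.25] -/
theorem isNaivelyIsotropic_of_hom_disc {B : C π} {t : PosReal} {Y : C π} (γ : disc B t ⟶ Y) :
    Y.fst.IsNaivelyIsotropic :=
  C0.isNaivelyIsotropic_of_hom_of_pow_surj γ.fst fun w => by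
    obtain ⟨z, hz⟩ := normOne_exists_pow_eq w (C0.degFr γ.fst)
    exact ⟨z, Set.mem_univ _, hz⟩

section Level

variable {hF : PreFrobenioid.IsFrobenioid (C.toElem π)} (X : pfCat π hF)
  (hPf : PreFrobenioid.IsFrobenioid (pfStr π hF)) {c k : ℕ+} (hc : (frobPow hF X.obj c).fst.IsNaivelyIsotropic)
  {t : PosReal}

/-- The level `(k, c·k)` for arrows `(disc_t over A^{(c)}, n·c) → (A, n)`. [cite: MochizukiFrdI2008, Def. 3.1 (iii) p.57] -/
abbrev levelK (c k : ℕ+) (t : PosReal) : Level (discPf X c t) X := ⟨k, c * k, mul_assoc _ _ _⟩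

omit hc in
/-- `(1, c) ≤ (k, c·k)`. [cite: MochizukiFrdI2008, Def. 3.1 (ii) p.56] -/
theorem le_levelK (c k : ℕ+) (t : PosReal) :
    (⟨1, c, mul_one _⟩ : Level (discPf X c t) X).LE (levelK X c k t) :=
  ⟨one_dvd _, dvd_mul_right c k⟩

/-- **The Frobenius conjugate, to level `(k, c·k)`, of the germ arrow `frob⁻¹ ≫ ι`** (`ι : disc_t → A^{(c)}`):
an arrow `(disc_t)^{(k)} → A^{(c·k)}` of `C` (Prop. 1.10 (i); the transition map of Def. 3.1 (ii)).
[cite: MochizukiFrdI2008, Def. 3.1 (ii) p.56] -/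
def liftK (k : ℕ+) (ι : disc (frobPow hF X.obj c) t ⟶ frobPow hF X.obj c) :
    frobPow hF (disc (frobPow hF X.obj c) t) k ⟶ frobPow hF X.obj (c * k) :=
  Level.lift (inclRep X c t ι).L (levelK X c k t) (le_levelK X c k t) (inclRep X c t ι).hom

omit hc in
/-- The defining square of `liftK`: `frobTrans_disc ≫ liftK ι = (frob⁻¹ ≫ ι) ≫ frobTrans_A`.
[cite: MochizukiFrdI2008, Prop. 1.10 (i) p.34] -/
theorem liftK_spec (k : ℕ+) (ι : disc (frobPow hF X.obj c) t ⟶ frobPow hF X.obj c) :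
    frobTrans hF (disc (frobPow hF X.obj c) t) (one_dvd k) ≫ liftK X k ι =
      (frobOneInv (hF := hF) (disc (frobPow hF X.obj c) t) ≫ ι) ≫ frobTrans hF X.obj (dvd_mul_right c k) :=
  Level.lift_spec _ _ (le_levelK X c k t) _

omit hc in
/-- The class of `liftK ι` at level `(k, c·k)` is the class of `frob⁻¹ ≫ ι` at level `(1, c)` (same perfected
morphism). [cite: MochizukiFrdI2008, Def. 3.1 (ii) p.56] -/
theorem mk_liftK (k : ℕ+) (ι : disc (frobPow hF X.obj c) t ⟶ frobPow hF X.obj c) :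
    Hom.mk (⟨levelK X c k t, liftK X k ι⟩ : Rep (discPf X c t) X) = inclHom X c t ι :=
  Hom.mk_lift (inclRep X c t ι) _ (le_levelK X c k t)

omit hc in
/-- `liftK ι` is a pre-step of `C` when `ι` is (Frobenius conjugation preserves pre-steps, Prop. 1.10 (i)).
[cite: MochizukiFrdI2008, Prop. 1.10 (i) p.34] -/
theorem isPreStep_liftK (k : ℕ+) {ι : disc (frobPow hF X.obj c) t ⟶ frobPow hF X.obj c}
    (hι : PreFrobenioid.IsCoAngularPreStep (C.toElem π) ι) : PreFrobenioid.IsPreStep (C.toElem π) (liftK X k ι) := by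
  haveI := Perfection.isIso_frob_one (hF := hF) (disc (frobPow hF X.obj c) t)
  have h : PreFrobenioid.IsPreStep (C.toElem π) (inclRep X c t ι).hom :=
    (PreFrobenioid.IsCoAngularPreStep.iso_comp (F := C.toElem π)
      (CategoryTheory.inv (frob hF (disc (frobPow hF X.obj c) t) 1)) hι).2
  exact (isPreStep_lift_iff (inclRep X c t ι) _ (le_levelK X c k t)).mpr h

omit hc in
/-- The `D`-component of `liftK ι` is an isomorphism. [cite: MochizukiFrdI2008, Prop. 1.10 (i) p.34] -/
theorem isIso_snd_liftK (k : ℕ+) {ι : disc (frobPow hF X.obj c) t ⟶ frobPow hF X.obj c}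
    (hι : PreFrobenioid.IsCoAngularPreStep (C.toElem π) ι) : IsIso (liftK X k ι).snd :=
  (isPreStep_liftK X k hι).2

omit hc in
/-- The `D₀`-base of the `C₀`-component of `liftK ι` is an isomorphism. [cite: MochizukiFrdI2008, Prop. 1.10 (i) p.34] -/
theorem isIso_base_liftK (k : ℕ+) {ι : disc (frobPow hF X.obj c) t ⟶ frobPow hF X.obj c}
    (hι : PreFrobenioid.IsCoAngularPreStep (C.toElem π) ι) : IsIso (C0.Base (liftK X k ι).fst) := by
  haveI := isIso_snd_liftK X k hι
  exact PreFrobenioid.isBaseIso_fst_of_isIso_snd (liftK X k ι)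

omit hc in
/-- `deg_Fr (liftK ι) = 1`. [cite: MochizukiFrdI2008, Prop. 1.10 (i) p.34] -/
theorem degFr_liftK (k : ℕ+) {ι : disc (frobPow hF X.obj c) t ⟶ frobPow hF X.obj c}
    (hι : PreFrobenioid.IsCoAngularPreStep (C.toElem π) ι) : C0.degFr (liftK X k ι).fst = 1 :=
  (isPreStep_liftK X k hι).1

/-! ### The conjugates of two scalar arrows: same base, same `D`-component, scalars in ratio `r^k` -/

/-- The scalar-`z` germ arrow at level `c`, radius `t`. [cite: MochizukiFrdII2008, Ex 3.3 (i) p.27] -/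
abbrev ιAt (z : ℂˣ) (hz : z ∈ D0.scalars (frobPow hF X.obj c).fst.base)
    (h : ‖(z : ℂ)‖ * t ≤ (frobPow hF X.obj c).fst.tip) : disc (frobPow hF X.obj c) t ⟶ frobPow hF X.obj c :=
  discIncl (frobPow hF X.obj c) hc t z hz h

/-- The `D`-components of the conjugates of two scalar arrows agree (both squares have the same `D`-part).
[cite: MochizukiFrdI2008, Prop. 1.10 (i) p.34] -/
theorem snd_liftK_eq (k : ℕ+) (ht : (t : ℝ) ≤ (frobPow hF X.obj c).fst.tip) (z : ℂˣ)
    (hz : z ∈ D0.scalars (frobPow hF X.obj c).fst.base) (h : ‖(z : ℂ)‖ * t ≤ (frobPow hF X.obj c).fst.tip) :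
    (liftK X k (ιAt X hc z hz h)).snd = (liftK X k (ιAt X hc 1 (one_mem _) (norm_one_mul_le ht))).snd := by
  haveI : IsIso (frobTrans hF (disc (frobPow hF X.obj c) t) (one_dvd k)).snd :=
    (isFrobeniusType_frobTrans hF (disc (frobPow hF X.obj c) t) (one_dvd k)).2
  have e₁ := congrArg CFP.Hom.snd (liftK_spec X k (ιAt X hc z hz h))
  have e₂ := congrArg CFP.Hom.snd (liftK_spec X k (ιAt X hc 1 (one_mem _) (norm_one_mul_le ht)))
  simp only [CFP.comp_snd, discIncl_snd] at e₁ e₂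
  exact (cancel_epi (frobTrans hF (disc (frobPow hF X.obj c) t) (one_dvd k)).snd).mp (e₁.trans e₂.symm)

/-- The `D₀`-bases of the conjugates of two scalar arrows agree. [cite: MochizukiFrdI2008, Prop. 1.10 (i) p.34] -/
theorem base_liftK_eq (k : ℕ+) (ht : (t : ℝ) ≤ (frobPow hF X.obj c).fst.tip) (z : ℂˣ)
    (hz : z ∈ D0.scalars (frobPow hF X.obj c).fst.base) (h : ‖(z : ℂ)‖ * t ≤ (frobPow hF X.obj c).fst.tip) :
    C0.Base (liftK X k (ιAt X hc z hz h)).fst =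
      C0.Base (liftK X k (ιAt X hc 1 (one_mem _) (norm_one_mul_le ht))).fst := by
  haveI : IsIso (C0.Base (frobTrans hF (disc (frobPow hF X.obj c) t) (one_dvd k)).fst) := by
    haveI : IsIso (frobTrans hF (disc (frobPow hF X.obj c) t) (one_dvd k)).snd :=
      (isFrobeniusType_frobTrans hF (disc (frobPow hF X.obj c) t) (one_dvd k)).2
    exact PreFrobenioid.isBaseIso_fst_of_isIso_snd (frobTrans hF (disc (frobPow hF X.obj c) t) (one_dvd k))
  have e₁ := congrArg (fun f => C0.Base (CFP.Hom.fst f)) (liftK_spec X k (ιAt X hc z hz h))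
  have e₂ := congrArg (fun f => C0.Base (CFP.Hom.fst f)) (liftK_spec X k (ιAt X hc 1 (one_mem _) (norm_one_mul_le ht)))
  simp only [CFP.comp_fst, C0.base_comp', base_discIncl] at e₁ e₂
  exact (cancel_epi (C0.Base (frobTrans hF (disc (frobPow hF X.obj c) t) (one_dvd k)).fst)).mp (e₁.trans e₂.symm)

/-- **The scalars of the conjugates of the scalar arrows `ι_r`, `ι_1` (`r > 0` real) are in the ratio `r^k`**:
both defining squares share every datum except the scalar of `ι`, which enters to the power
`k = deg_Fr(frobTrans)`; positive reals are fixed by every Galois twist. [cite: MochizukiFrdI2008, Prop. 1.10 (i) p.34] -/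
theorem scalar_liftK_eq (k : ℕ+) (ht : (t : ℝ) ≤ (frobPow hF X.obj c).fst.tip) (r : PosReal)
    (h : ‖((ofPosReal ℂ r : ℂˣ) : ℂ)‖ * t ≤ (frobPow hF X.obj c).fst.tip) :
    C0.scalar (liftK X k (ιAt X hc (ofPosReal ℂ r) (ofPosReal_mem_scalars _ _) h)).fst =
      C0.scalar (liftK X k (ιAt X hc 1 (one_mem _) (norm_one_mul_le ht))).fst * (ofPosReal ℂ r) ^ (k : ℕ) := by
  have hdeg : C0.degFr (frobTrans hF X.obj (dvd_mul_right c k)).fst = k := by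
    have : c * PreFrobenioid.degFr (C.toElem π) (frobTrans hF X.obj (dvd_mul_right c k)) = c * k :=
      degFr_frobTrans hF X.obj (dvd_mul_right c k)
    exact mul_left_cancel this
  have e₁ := congrArg (fun f => C0.scalar (CFP.Hom.fst f)) (liftK_spec X k (ιAt X hc (ofPosReal ℂ r)
    (ofPosReal_mem_scalars _ _) h))
  have e₂ := congrArg (fun f => C0.scalar (CFP.Hom.fst f)) (liftK_spec X k (ιAt X hc 1 (one_mem _)
    (norm_one_mul_le ht)))
  simp only [CFP.comp_fst, C0.scalar_comp', C0.base_comp', scalar_discIncl, degFr_discIncl, base_discIncl,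
    hdeg, degFr_liftK X k (isCoAngularPreStep_discIncl hc t _ _ _), PNat.one_coe, pow_one, map_one, mul_pow] at e₁ e₂
  -- the Galois twists fix the positive real `r`
  have hfix : ∀ σ : Bool, D0.galAct σ (ofPosReal ℂ r) = ofPosReal ℂ r := fun σ =>
    D0.galAct_eq_self_of_mem_scalars_real σ (ofPosReal_mem_scalars r D0.real)
  have ha := eq_mul_inv_of_mul_eq e₁
  have hb := eq_mul_inv_of_mul_eq e₂
  simp only [D0.Hom.act, hfix, one_pow, one_mul] at ha hb
  have key : D0.galAct (D0.Hom.twists (C0.Base (frobTrans hF (disc (frobPow hF X.obj c) t) (one_dvd k)).fst))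
        (C0.scalar (liftK X k (ιAt X hc (ofPosReal ℂ r) (ofPosReal_mem_scalars _ _) h)).fst) =
      D0.galAct (D0.Hom.twists (C0.Base (frobTrans hF (disc (frobPow hF X.obj c) t) (one_dvd k)).fst))
        (C0.scalar (liftK X k (ιAt X hc 1 (one_mem _) (norm_one_mul_le ht))).fst) * (ofPosReal ℂ r) ^ (k : ℕ) := by
    rw [ha, hb]
    ac_rfl
  have := congrArg (D0.galAct (D0.Hom.twists (C0.Base (frobTrans hF (disc (frobPow hF X.obj c) t) (one_dvd k)).fst))) key
  rw [map_mul, map_pow, D0.galAct_galAct, D0.galAct_galAct, hfix] at this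
  exact this


/-! ### The refining arrow `disc′ → (disc)^{(k)}` and the level-change relation -/

variable (hck : (frobPow hF X.obj (c * k)).fst.IsNaivelyIsotropic) (ht : (t : ℝ) ≤ (frobPow hF X.obj c).fst.tip)

/-- The conjugate `L₁` of the scalar-`1` germ arrow (abbreviation). [cite: MochizukiFrdI2008, Prop. 1.10 (i) p.34] -/
abbrev liftOne (k : ℕ+) (ht : (t : ℝ) ≤ (frobPow hF X.obj c).fst.tip) :
    frobPow hF (disc (frobPow hF X.obj c) t) k ⟶ frobPow hF X.obj (c * k) :=
  liftK X k (ιAt X hc 1 (one_mem _) (norm_one_mul_le ht))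

/-- The scalar of the refining arrow: `((Base L₁)⁻¹ · scalar L₁)⁻¹`. [cite: MochizukiFrdI2008, Def. 3.1 (ii) p.56] -/
def levelScalar (k : ℕ+) (ht : (t : ℝ) ≤ (frobPow hF X.obj c).fst.tip) : ℂˣ :=
  ((CategoryTheory.inv (C0.Base (liftOne X hc k ht).fst)
      (I := isIso_base_liftK X k (isCoAngularPreStep_discIncl hc t 1 _ _))).act (C0.scalar (liftOne X hc k ht).fst))⁻¹

/-- **The refining arrow `disc_{t′} → (disc_t)^{(k)}`** (over `A^{(c·k)}`, into the `k`-th Frobenius power of the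
source disc of level `c`): base and `D`-component the inverses of those of `L₁`, degree `1`, scalar `levelScalar` —
so that `levelHom ≫ L₁` is the scalar-`1` arrow. [cite: MochizukiFrdI2008, Def. 3.1 (ii) p.56] -/
def levelHom (t' : PosReal)
    (h' : ‖(levelScalar X hc k ht : ℂ)‖ * t' ≤ (frobPow hF (disc (frobPow hF X.obj c) t) k).fst.tip) :
    disc (frobPow hF X.obj (c * k)) t' ⟶ frobPow hF (disc (frobPow hF X.obj c) t) k :=
  haveI := isIso_base_liftK X k (isCoAngularPreStep_discIncl hc t 1 (one_mem _) (norm_one_mul_le ht))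
  haveI := isIso_snd_liftK X k (isCoAngularPreStep_discIncl hc t 1 (one_mem _) (norm_one_mul_le ht))
  { fst :=
      { base := (CategoryTheory.inv (C0.Base (liftOne X hc k ht).fst) :
          (frobPow hF X.obj (c * k)).fst.base ⟶ (frobPow hF (disc (frobPow hF X.obj c) t) k).fst.base)
        degFr := 1
        scalar := levelScalar X hc k ht
        scalar_mem := inv_mem (C0.act_mem_scalars _ (liftOne X hc k ht).fst.scalar_mem)
        mapsTo := by
          rw [PNat.one_coe, pow_one]
          rintro _ ⟨u, hu, rfl⟩
          rw [C0.mem_carrier_of_isIsotropic (AngularRegion.isIsotropic_isotropicOfTip t'), ← Subtype.coe_le_coe,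
            coe_absHom] at hu
          refine ⟨(CategoryTheory.inv (C0.Base (liftOne X hc k ht).fst) :
              (frobPow hF X.obj (c * k)).fst.base ⟶ (frobPow hF (disc (frobPow hF X.obj c) t) k).fst.base).act
              (levelScalar X hc k ht * u), ?_, D0.galAct_galAct _ _⟩
          rw [C0.mem_carrier_of_isIsotropic (isNaivelyIsotropic_of_hom_disc (frob hF (disc (frobPow hF X.obj c) t) k)),
            ← Subtype.coe_le_coe, coe_absHom, D0.norm_galAct]
          rw [Units.val_mul, norm_mul]
          exact (mul_le_mul_of_nonneg_left hu (norm_nonneg _)).trans h' }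
    snd := CategoryTheory.inv (liftOne X hc k ht).snd
    w := by
      have w := (liftOne X hc k ht).w
      change C0.Base (liftOne X hc k ht).fst ≫ (frobPow hF X.obj (c * k)).iso.hom =
        (frobPow hF (disc (frobPow hF X.obj c) t) k).iso.hom ≫ π.map (liftOne X hc k ht).snd at w
      change CategoryTheory.inv (C0.Base (liftOne X hc k ht).fst) ≫ (frobPow hF (disc (frobPow hF X.obj c) t) k).iso.hom =
        (frobPow hF X.obj (c * k)).iso.hom ≫ π.map (CategoryTheory.inv (liftOne X hc k ht).snd)
      rw [Functor.map_inv, IsIso.inv_comp_eq]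
      exact ((IsIso.eq_comp_inv _).mpr w.symm).trans (Category.assoc _ _ _) }

/-- `Base` of the refining arrow. [cite: MochizukiFrdI2008, Def. 3.1 (ii) p.56] -/
theorem base_levelHom (t' : PosReal)
    (h' : ‖(levelScalar X hc k ht : ℂ)‖ * t' ≤ (frobPow hF (disc (frobPow hF X.obj c) t) k).fst.tip) :
    C0.Base (levelHom X hc ht t' h').fst =
      CategoryTheory.inv (C0.Base (liftOne X hc k ht).fst)
        (I := isIso_base_liftK X k (isCoAngularPreStep_discIncl hc t 1 (one_mem _) (norm_one_mul_le ht))) := rfl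

/-- `deg_Fr` of the refining arrow. [cite: MochizukiFrdI2008, Def. 3.1 (ii) p.56] -/
theorem degFr_levelHom (t' : PosReal)
    (h' : ‖(levelScalar X hc k ht : ℂ)‖ * t' ≤ (frobPow hF (disc (frobPow hF X.obj c) t) k).fst.tip) :
    C0.degFr (levelHom X hc ht t' h').fst = 1 := rfl

/-- The scalar of the refining arrow. [cite: MochizukiFrdI2008, Def. 3.1 (ii) p.56] -/
theorem scalar_levelHom (t' : PosReal)
    (h' : ‖(levelScalar X hc k ht : ℂ)‖ * t' ≤ (frobPow hF (disc (frobPow hF X.obj c) t) k).fst.tip) :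
    C0.scalar (levelHom X hc ht t' h').fst = levelScalar X hc k ht := rfl

/-- The `D`-component of the refining arrow. [cite: MochizukiFrdI2008, Def. 3.1 (ii) p.56] -/
theorem levelHom_snd (t' : PosReal)
    (h' : ‖(levelScalar X hc k ht : ℂ)‖ * t' ≤ (frobPow hF (disc (frobPow hF X.obj c) t) k).fst.tip) :
    (levelHom X hc ht t' h').snd = CategoryTheory.inv (liftOne X hc k ht).snd
      (I := isIso_snd_liftK X k (isCoAngularPreStep_discIncl hc t 1 (one_mem _) (norm_one_mul_le ht))) := rfl

/-- The defining identity of the scalar of the refining arrow. [cite: MochizukiFrdI2008, Def. 3.1 (ii) p.56] -/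
theorem act_scalar_mul_levelScalar :
    (CategoryTheory.inv (C0.Base (liftOne X hc k ht).fst)
        (I := isIso_base_liftK X k (isCoAngularPreStep_discIncl hc t 1 (one_mem _) (norm_one_mul_le ht)))).act
        (C0.scalar (liftOne X hc k ht).fst) * levelScalar X hc k ht = 1 :=
  mul_inv_cancel _

/-- `levelHom ≫ L₁` is the scalar-`1` arrow `disc_{t′} → A^{(c k)}`. [cite: MochizukiFrdI2008, Def. 3.1 (ii) p.56] -/
theorem levelHom_comp_liftOne (t' : PosReal)
    (h' : ‖(levelScalar X hc k ht : ℂ)‖ * t' ≤ (frobPow hF (disc (frobPow hF X.obj c) t) k).fst.tip)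
    (ht' : (t' : ℝ) ≤ (frobPow hF X.obj (c * k)).fst.tip) :
    levelHom X hc ht t' h' ≫ liftOne X hc k ht = discIncl (frobPow hF X.obj (c * k)) hck t' 1 (one_mem _) (norm_one_mul_le ht') := by
  haveI := isIso_base_liftK X k (isCoAngularPreStep_discIncl hc t 1 (one_mem _) (norm_one_mul_le ht))
  haveI := isIso_snd_liftK X k (isCoAngularPreStep_discIncl hc t 1 (one_mem _) (norm_one_mul_le ht))
  refine CFP.hom_ext (C0.hom_ext ?_ ?_ ?_) ?_
  · rw [CFP.comp_fst, C0.base_comp', base_levelHom, IsIso.inv_hom_id]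
    rfl
  · change (1 : ℕ+) * C0.degFr (liftOne X hc k ht).fst = 1
    rw [degFr_liftK X k (isCoAngularPreStep_discIncl hc t 1 _ _), mul_one]
  · rw [CFP.comp_fst, C0.scalar_comp', degFr_liftK X k (isCoAngularPreStep_discIncl hc t 1 _ _), PNat.one_coe, pow_one,
      base_levelHom, scalar_levelHom, act_scalar_mul_levelScalar]
    rfl
  · rw [CFP.comp_snd, levelHom_snd, IsIso.inv_hom_id]
    rfl

/-- `levelHom ≫ L_r` is the scalar-`r^k` arrow `disc_{t′} → A^{(c k)}` (`r > 0` real).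
[cite: MochizukiFrdI2008, Def. 3.1 (ii) p.56] -/
theorem levelHom_comp_liftK (t' : PosReal)
    (h' : ‖(levelScalar X hc k ht : ℂ)‖ * t' ≤ (frobPow hF (disc (frobPow hF X.obj c) t) k).fst.tip)
    (r : PosReal) (h : ‖((ofPosReal ℂ r : ℂˣ) : ℂ)‖ * t ≤ (frobPow hF X.obj c).fst.tip)
    (hk : ‖((ofPosReal ℂ r ^ (k : ℕ) : ℂˣ) : ℂ)‖ * t' ≤ (frobPow hF X.obj (c * k)).fst.tip) :
    levelHom X hc ht t' h' ≫ liftK X k (ιAt X hc (ofPosReal ℂ r) (ofPosReal_mem_scalars _ _) h) =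
      discIncl (frobPow hF X.obj (c * k)) hck t' (ofPosReal ℂ r ^ (k : ℕ)) (pow_mem (ofPosReal_mem_scalars _ _) _) hk := by
  haveI := isIso_base_liftK X k (isCoAngularPreStep_discIncl hc t 1 (one_mem _) (norm_one_mul_le ht))
  haveI := isIso_snd_liftK X k (isCoAngularPreStep_discIncl hc t 1 (one_mem _) (norm_one_mul_le ht))
  have hfix : ∀ σ : Bool, D0.galAct σ (ofPosReal ℂ r) = ofPosReal ℂ r := fun σ =>
    D0.galAct_eq_self_of_mem_scalars_real σ (ofPosReal_mem_scalars r D0.real)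
  refine CFP.hom_ext (C0.hom_ext ?_ ?_ ?_) ?_
  · rw [CFP.comp_fst, C0.base_comp', base_liftK_eq X hc k ht (ofPosReal ℂ r) _ h, base_levelHom, IsIso.inv_hom_id]
    rfl
  · change (1 : ℕ+) * C0.degFr (liftK X k _).fst = 1
    rw [degFr_liftK X k (isCoAngularPreStep_discIncl hc t _ _ _), mul_one]
  · rw [CFP.comp_fst, C0.scalar_comp', degFr_liftK X k (isCoAngularPreStep_discIncl hc t _ _ _), PNat.one_coe,
      pow_one, scalar_liftK_eq X hc k ht r h, map_mul, map_pow, base_levelHom, scalar_levelHom, D0.Hom.act, hfix,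
      mul_right_comm]
    change _ * levelScalar X hc k ht * _ = (ofPosReal ℂ r) ^ (k : ℕ)
    rw [show D0.galAct (D0.Hom.twists (CategoryTheory.inv (C0.Base (liftOne X hc k ht).fst)))
        (C0.scalar (liftOne X hc k ht).fst) * levelScalar X hc k ht = 1 from act_scalar_mul_levelScalar X hc ht,
      one_mul]
  · rw [CFP.comp_snd, snd_liftK_eq X hc k ht (ofPosReal ℂ r) _ h, levelHom_snd, IsIso.inv_hom_id]
    rfl

end Level

end Thm36Sub

end ArchFrd

end Literature.AlgebraicGeometry.Frobenioids

end
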